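/-
Copyright (c) 2026 the pub-hodgecm-mathlib formalisation cell (harness21).  Prover seat hodgecm-mathlib-K2Liu-p07 (g3), Track B «K2-LIT»,
#184♮ = hLiu418 = `stmt-HodgeConjecture-24832`; #42S payer road, organ S1 (local Siegel–Weil spanning), ROAD W file F7r-5 (the `hf₀off` glue)
(LEAD F0P6-plan (g14) BATCH #16∕#18; DESIGN-F7r-Assembly §3 row `hf₀off`; K2E5-p17 (g7) (R-a) ★ p860339∕p860361).
-/
import Summits.HodgeConjecture.HodgeConjecture.Theorems.K2LiuLocalSWRamifiedMiddleCell     -- ★ F7r-4: the two cells, by value (+ ★ F7r-1 `offBigCell_add_mul_comp`)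
import Summits.HodgeConjecture.HodgeConjecture.Theorems.K2LiuLocalSWRamifiedRankOneSign    -- ★ F7r-2: flips (`localCongr_dA_flip`, …) and the sign `χ_s(ℓ₁) = −1`
import Summits.HodgeConjecture.HodgeConjecture.Theorems.K2LiuLocalSWMiddleCellBruhat        -- ★ (R-a) K2E5-p17: `offBigCell_cases` (`n = 2` Bruhat off the big cell)
import HarnessLib

/-!
# Crux `HLiu418`, #42S organ S1, ROAD W, file F7r-5: THE SOCKET BINDER `hf₀off` OF THE RAMIFIED WITNESS `f₀ = F + μ·(F ∘ Ad d_a)` AT `n = 2`,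
# FROM `F(1) = 0` AND THE DILATION INVARIANCE (d) ALONE

Cell `hodgecm-mathlib`, crux item hLiu418 = `stmt-HodgeConjecture-24832`; squad K2 ∕ K2Liu; LEAD F0P6-plan (g14), organ lead K2Liu-p06 (g4);
prover K2Liu-p07 (g3).  THEOREMS ONLY (no `def`, no instance, no notation, no named-fact hypothesis, no `sorry`); lane
`--supports stmt-HodgeConjecture-24832 --as helper`.

WHY.  Composition of three ★ pieces into the LITERAL `hf₀off` binder of ★ F3d `localDegPS_le_of_witness` for the ramified witness at `n = 2` (non-split `v`):
★ F7r-1 `offBigCell_add_mul_comp` (binder ⟸ eigen-relation (H-mid) + `μκ₁ = −1`) ∘ ★ F7r-4 `offBigCell_comp_eq_of_cells` ((H-mid) ⟸ closed cell `F(1) = 0` + middle cell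
(d) + flip letters + `hcell`) ∘ ★ (R-a) `K2LiuLocalSWMiddleCellBruhat.offBigCell_cases` (`hcell`: off the big cell, `g ∈ P_Δ` or `g = p·w₁·x`, `E ⊗ F_v` a field) ∘ ★ F7r-2
(`localCongr_dA_flip`: `Ad(d_a) w₁ = ℓ₁ w₁`; `isSiegelDelta_localCongr_dA_flip_mul`; `detDelta_localCongr_dA_flipSingle_mul` + `localSiegelCharacter_eq_neg_one_of_detDelta`: `χ_s(ℓ₁) = −1`).
* `offBigCell_add_mul_localCongr_dA_eq_zero` — generic quadratic `E∕F`, any `χv`, `s`, `μ` with `μ·χ_s(ℓ₁) = −1`: `F g + μ F(Ad_{d_a} g) = 0` off the big cell, from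
  `F(1) = 0` and (d) `F(w₁ · Ad_{d_a} x) = F(w₁ · x)` (`x ∈ P_Δ`);
* **`offBigCell_add_localCongr_dA_eq_zero`** — Kudla's CM datum (`χv w = χ_w⁻¹`, `χ` weight-one splitting), `a` a `v`-unit local non-norm: `μ = 1`, i.e.
  `F g + F(Ad_{d_a} g) = 0` off the big cell — the `hf₀off` of `f₀ = F + F ∘ Ad(d_a)`.
References: [Kudla1994] §3 Thm. 3.1; [KudlaSweet1997] §1; [HarrisKudlaSweet1996] §1 (1.5), (1.15); [BernsteinZelevinsky1976] §1.5.
HONEST LABEL.  Count-neutral helper: `HC_CM` is proved only modulo the 7 printed citations (2 remaining named inputs: hLiu418 = `stmt-HodgeConjecture-24832`,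
h413 = `stmt-HodgeConjecture-24833`) until rung 0 closes.
-/

set_option autoImplicit false
set_option linter.dupNamespace false -- the mandated namespace repeats `HodgeConjecture.HodgeConjecture`

noncomputable section

open scoped Matrix
open NumberField IsDedekindDomain Matrix
open Literature.NumberTheory.Automorphic Literature.NumberTheory.Automorphic.UnitaryGroup
open Literature.NumberTheory.GelbartRogawski1991.AdaptedBlocks
open Literature.NumberTheory.GelbartRogawski1991.UnitaryDualPair.LocalSplitting
open Literature.NumberTheory.K2Lit.LocalSiegelDoubled
open Summit.HodgeConjecture.HodgeConjecture.Cruxes.HLiu418.K2LiuLocalSWSimilitudeAlgebra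
open Summit.HodgeConjecture.HodgeConjecture.Cruxes.HLiu418.K2LiuLocalSWSimilitudeSections
open Summit.HodgeConjecture.HodgeConjecture.Cruxes.HLiu418.K2LiuLocalSWRamifiedRelativeSign
open Summit.HodgeConjecture.HodgeConjecture.Cruxes.HLiu418.K2LiuLocalSWRamifiedMiddleCell
open Summit.HodgeConjecture.HodgeConjecture.Cruxes.HLiu418.K2LiuLocalSWRamifiedRankOneSign
open Summit.HodgeConjecture.HodgeConjecture.Cruxes.HLiu418.K2LiuLocalSWMiddleCellBruhat

namespace Summit.HodgeConjecture.HodgeConjecture.Cruxes.HLiu418.K2LiuLocalSWRamifiedOffBigCell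

/-! ## §1 Generic quadratic `E∕F`: `hf₀off` for `f₀ = F + μ·(F ∘ Ad d_a)` with `μ·χ_s(ℓ₁) = −1` -/

section Generic

variable (F : Type) [Field F] [NumberField F] (E : Type) [Field E] [NumberField E] [Algebra F E] [Algebra.IsQuadraticExtension F E]
  (c : E ≃ₐ[F] E) {δ : E} (hcδ : c δ = -δ) (hδ : δ ≠ 0) {d : F} (hd : δ * δ = algebraMap F E d)
  (v : HeightOneSpectrum (𝓞 F)) {T₀ : Matrix (Fin 2) (Fin 2) F} (hT₀ : T₀.IsSymm) (hT₀d : IsUnit T₀.det)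
  {JD : Matrix (Fin (2 + 2)) (Fin (2 + 2)) E} (hJD : JD = (gramD F 2 T₀).map (algebraMap F E))
  (χv : ∀ w : PlacesOver E v, (w.1.adicCompletion E)ˣ →* ℂˣ) (s : ℂ)
  (a : Fˣ) {D₀ : GL (Fin (2 + 2)) F}
  (hD₀ : (D₀ : Matrix (Fin (2 + 2)) (Fin (2 + 2)) F) =
    Matrix.reindex (e₂ 2) (e₂ 2) (cayR F (Fin 2) * Matrix.fromBlocks 1 0 0 ((a : F) • (1 : Matrix (Fin 2) (Fin 2) F)) * cayRinv F (Fin 2)))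
  {DA : GL (Fin (2 + 2)) E} (hDA : DA = Matrix.GeneralLinearGroup.map (algebraMap F E) D₀)
  {b : E} (hb : b ≠ 0) (hDAJ : formCongr (c : E →+* E) DA (b • JD) = JD)

include hD₀ hDA hT₀d in
/-- **`hf₀off` FOR `f₀ = F + μ·(F ∘ Ad d_a)`, `n = 2`, NON-SPLIT `v`** (`E ⊗ F_v` a field: `hK`): for a Siegel section `F ∈ I_v(s, χ_v)` with `F(1) = 0`, a flip `w₁` of the line
`i` (`hw₁`), the dilation invariance (d) `F(w₁ · Ad_{d_a} x) = F(w₁ · x)` on `P_Δ`, and `μ·χ_s(ℓ₁) = −1` (`ℓ₁ = Ad_{d_a}(w₁)·w₁`): `F g + μ·F(Ad_{d_a} g) = 0` for every `g` off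
the big cell `P_Δ w_Δ N_Δ`. [cite: Kudla1994, §3 Thm. 3.1] [cite: KudlaSweet1997, §1] -/
theorem offBigCell_add_mul_localCongr_dA_eq_zero (hK : ∀ z : LocalRing E v, z ≠ 0 → IsUnit z) (i : Fin 2)
    {w₁ : UnitaryGroup.localPi E c (2 + 2) JD v}
    (hw₁ : adapt (matA F E c v 2 w₁) = Matrix.fromBlocks (1 - Matrix.single i i 1) (Matrix.single i i 1) (Matrix.single i i 1) (1 - Matrix.single i i 1))
    {F₀ : UnitaryGroup.localPi E c (2 + 2) JD v → ℂ} (hF : IsLocalSiegelSection F E c hcδ hδ hd v 2 hT₀ hJD χv s F₀) (h1 : F₀ 1 = 0)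
    (hd₁ : ∀ x, IsSiegelDelta F E c hcδ hδ hd v 2 hT₀ hJD x → F₀ (w₁ * localCongr E c DA hb hDAJ v x) = F₀ (w₁ * x))
    {μ : ℂ} (hμ : μ * localSiegelCharacter F E c v 2 χv s (localCongr E c DA hb hDAJ v w₁ * w₁) = -1)
    (g : UnitaryGroup.localPi E c (2 + 2) JD v)
    (hg : ¬ ∃ p, IsSiegelDelta F E c hcδ hδ hd v 2 hT₀ hJD p ∧ ∃ u ∈ unipDeltaLocal F E c v 2 (JD := JD), g = p * weylDelta F E c v 2 hJD * u) :
    F₀ g + μ * F₀ (localCongr E c DA hb hDAJ v g) = 0 := by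
  classical
  have hP : Matrix.single i i (1 : LocalRing E v) * Matrix.single i i 1 = Matrix.single i i 1 := by
    rw [Matrix.single_mul_single_same, mul_one]
  have hθP : ∀ p, IsSiegelDelta F E c hcδ hδ hd v 2 hT₀ hJD p → IsSiegelDelta F E c hcδ hδ hd v 2 hT₀ hJD ((localCongr E c DA hb hDAJ v).toMonoidHom p) :=
    fun p hp => (isSiegelDelta_localCongr_dA_iff F E c v 2 hJD a hD₀ hDA hb hDAJ hcδ hδ hd hT₀ p).2 hp
  have hχθ : ∀ p, IsSiegelDelta F E c hcδ hδ hd v 2 hT₀ hJD p →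
      localSiegelCharacter F E c v 2 χv s ((localCongr E c DA hb hDAJ v).toMonoidHom p) = localSiegelCharacter F E c v 2 χv s p :=
    fun p hp => localSiegelCharacter_localCongr_dA F E c hcδ hδ hd v 2 hT₀ hJD χv s a hD₀ hDA hb hDAJ hp
  have key := offBigCell_add_mul_comp F E c hcδ hδ hd v 2 hT₀ hJD (localCongr E c DA hb hDAJ v).toMonoidHom F₀ μ hμ
    (offBigCell_comp_eq_of_cells F E c hcδ hδ hd v 2 hT₀ hJD χv s (localCongr E c DA hb hDAJ v).toMonoidHom hθP hχθ hF
      (localCongr_dA_flip F E c v 2 hb hDAJ hP hw₁) (isSiegelDelta_localCongr_dA_flip_mul F E c hcδ hδ hd v 2 hT₀ hJD a hD₀ hDA hb hDAJ hP hw₁) h1 hd₁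
      (offBigCell_cases F E c hcδ hδ hd v hT₀ hT₀d hJD hK i hw₁)) g hg
  exact key

end Generic

/-! ## §2 Kudla's CM datum: `μ = 1` -/

section CM

open Literature.NumberTheory.QuadraticForms Literature.RepresentationTheory.HarrisKudlaSweet1996 Literature.NumberTheory.GaloisRepresentations
open Literature.NumberTheory.GelbartRogawski1991.UnitaryDualPair

variable (L : Type) [Field L] [NumberField L] [IsCMField L] (v : HeightOneSpectrum (𝓞 (maximalRealSubfield L)))
  {T₀ : Matrix (Fin 2) (Fin 2) (maximalRealSubfield L)} (hT₀ : T₀.IsSymm) (hT₀d : IsUnit T₀.det)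
  {JD : Matrix (Fin (2 + 2)) (Fin (2 + 2)) L} (hJD : JD = (gramD (maximalRealSubfield L) 2 T₀).map (algebraMap (maximalRealSubfield L) L))
  (χ : HeckeCharacter L) (hχ : IsSplittingChar L 1 χ) (s : ℂ)
  (w₀ : PlacesOver L v) (hw₀ : IsCMField.complexConj L • w₀.1 = w₀.1)
  (a : (maximalRealSubfield L)ˣ)
  (ha₁ : ‖toPlace v w₀ ((a : maximalRealSubfield L) : v.adicCompletion (maximalRealSubfield L))‖ = 1)
  (ha : hilbertSymbol (v.adicCompletion (maximalRealSubfield L)) ((imagUnitSq L : maximalRealSubfield L) : v.adicCompletion (maximalRealSubfield L))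
    ((a : maximalRealSubfield L) : v.adicCompletion (maximalRealSubfield L)) = -1)
  {D₀ : GL (Fin (2 + 2)) (maximalRealSubfield L)}
  (hD₀ : (D₀ : Matrix (Fin (2 + 2)) (Fin (2 + 2)) (maximalRealSubfield L)) =
    Matrix.reindex (e₂ 2) (e₂ 2) (cayR (maximalRealSubfield L) (Fin 2) *
      Matrix.fromBlocks 1 0 0 ((a : maximalRealSubfield L) • (1 : Matrix (Fin 2) (Fin 2) (maximalRealSubfield L))) * cayRinv (maximalRealSubfield L) (Fin 2)))
  {DA : GL (Fin (2 + 2)) L} (hDA : DA = Matrix.GeneralLinearGroup.map (algebraMap (maximalRealSubfield L) L) D₀)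
  {b : L} (hb : b ≠ 0) (hDAJ : formCongr ((IsCMField.complexConj L : L ≃ₐ[maximalRealSubfield L] L) : L →+* L) DA (b • JD) = JD)

include hχ hw₀ ha₁ ha hD₀ hDA hT₀d in
/-- **`hf₀off` FOR THE RAMIFIED WITNESS `f₀ = F + F ∘ Ad(d_a)`** (Kudla's CM datum, `χv w = χ_w⁻¹`, `v` non-split, `a` a `v`-unit with `(δ², a)_v = −1`): for a Siegel section `F`
with `F(1) = 0`, a flip `w₁` of a line and the dilation invariance (d) on `P_Δ`: `F g + F(Ad_{d_a} g) = 0` off the big cell (`μ = 1` since `χ_s(ℓ₁) = −1`, ★ F7r-2).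
[cite: Kudla1994, §3 Thm. 3.1] [cite: KudlaSweet1997, §1] [cite: HarrisKudlaSweet1996, §1 (1.5), (1.15)] -/
theorem offBigCell_add_localCongr_dA_eq_zero (hK : ∀ z : LocalRing L v, z ≠ 0 → IsUnit z) (i : Fin 2)
    {w₁ : UnitaryGroup.localPi L (IsCMField.complexConj L) (2 + 2) JD v}
    (hw₁ : adapt (matA (maximalRealSubfield L) L (IsCMField.complexConj L) v 2 w₁) =
      Matrix.fromBlocks (1 - Matrix.single i i 1) (Matrix.single i i 1) (Matrix.single i i 1) (1 - Matrix.single i i 1))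
    {F₀ : UnitaryGroup.localPi L (IsCMField.complexConj L) (2 + 2) JD v → ℂ}
    (hF : IsLocalSiegelSection (maximalRealSubfield L) L (IsCMField.complexConj L) (complexConj_imagUnit L) (imagUnit_ne_zero L) (imagUnit_mul_self L)
      v 2 hT₀ hJD (fun w => (χ.localComponent w.1)⁻¹) s F₀) (h1 : F₀ 1 = 0)
    (hd₁ : ∀ x, IsSiegelDelta (maximalRealSubfield L) L (IsCMField.complexConj L) (complexConj_imagUnit L) (imagUnit_ne_zero L) (imagUnit_mul_self L) v 2 hT₀ hJD x →
      F₀ (w₁ * localCongr L (IsCMField.complexConj L) DA hb hDAJ v x) = F₀ (w₁ * x))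
    (g : UnitaryGroup.localPi L (IsCMField.complexConj L) (2 + 2) JD v)
    (hg : ¬ ∃ p, IsSiegelDelta (maximalRealSubfield L) L (IsCMField.complexConj L) (complexConj_imagUnit L) (imagUnit_ne_zero L) (imagUnit_mul_self L) v 2 hT₀ hJD p ∧
      ∃ u ∈ unipDeltaLocal (maximalRealSubfield L) L (IsCMField.complexConj L) v 2 (JD := JD),
        g = p * weylDelta (maximalRealSubfield L) L (IsCMField.complexConj L) v 2 hJD * u) :
    F₀ g + F₀ (localCongr L (IsCMField.complexConj L) DA hb hDAJ v g) = 0 := by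
  have hsign : localSiegelCharacter (maximalRealSubfield L) L (IsCMField.complexConj L) v 2 (fun w => (χ.localComponent w.1)⁻¹) s
      (localCongr L (IsCMField.complexConj L) DA hb hDAJ v w₁ * w₁) = -1 :=
    localSiegelCharacter_eq_neg_one_of_detDelta L v 2 χ hχ s w₀ hw₀ a ha₁ ha
      (detDelta_localCongr_dA_flipSingle_mul (maximalRealSubfield L) L (IsCMField.complexConj L) v 2 a hD₀ hDA hb hDAJ i hw₁)
  have hμ : (1 : ℂ) * localSiegelCharacter (maximalRealSubfield L) L (IsCMField.complexConj L) v 2 (fun w => (χ.localComponent w.1)⁻¹) s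
      (localCongr L (IsCMField.complexConj L) DA hb hDAJ v w₁ * w₁) = -1 := by rw [hsign, one_mul]
  have h := offBigCell_add_mul_localCongr_dA_eq_zero (maximalRealSubfield L) L (IsCMField.complexConj L) (complexConj_imagUnit L) (imagUnit_ne_zero L)
    (imagUnit_mul_self L) v hT₀ hT₀d hJD _ s a hD₀ hDA hb hDAJ hK i hw₁ hF h1 hd₁ hμ g hg
  rwa [one_mul] at h

end CM

end Summit.HodgeConjecture.HodgeConjecture.Cruxes.HLiu418.K2LiuLocalSWRamifiedOffBigCell
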